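import Summits.QuantumFields.YangMills.Theorems.BalabanUVNodesN21TwoRunDeviceOfBgCloseness
import Summits.QuantumFields.YangMills.Theorems.BalabanUVNodesN21ShellSplitOfRecord13CoPHStat

/-!
# N21 (NE7c) · FROM SUP-CLOSENESS OF THE TESTED CUBE STATISTICS TO THE PLAQUETTE-WISE DOMINATION BINDERS of this seat's junction (files 3, 5, 6, 8): the two-run closeness stated
# as ONE inequality per cube — `|sup_{q⊂c^∼}|U^A(∂q)−1|∕η² − sup_{q′⊂(ιc)^∼}|U^B(∂q′)−1|∕η′²| ≤ Δ` — gives BOTH `hAB` and `hBA`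

Track A of `YM-PLAN.md` (cell `pub-ymgap`), node **N21** (NE7c, NOT PRINTED); WIDTH SEAT `pub-ymgap-dag-n21-w2` (gen 3), file 9.  THEOREMS ONLY: 0 `def`, 0 `sorry`; COUNT-NEUTRAL;
`--kind proof --supports stmt-QuantumFields-27366 --as helper` (K3⁸).  Imports this seat's file 3 `…TwoRunDeviceOfBgCloseness` (p625475 ✓) and dag-n21-d's `…ShellSplitOfRecord13CoPHStat`
(p597562 ✓: `plaqInside_cubeEnl_nonempty`, `eta_pos_record`; → `…Defs` `cubeStat`).  No Theses import; restates nothing; the per-cube sup statistic is written INLINE (`Finset.sup'` over the finite plaquette family — the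
χ_{k+1}-level twin of dag-n21-d's `cubeStat`, which is stated at the χ_k cubes; no new object minted).

WHY.  Files 3 ∕ 5 ∕ 6 ∕ 8 display N16's two-run closeness as two ∀∃-domination binders `hAB ∕ hBA` per cube (the form the device consumes).  The NATURAL statement a closeness
producer (N16 ∕ N19′) would deliver is one number per cube: the tested (2.17) statistic `sup_{q ⊂ c^∼} |U_{k+1,c}(V)(∂q) − 1| ∕ η_{k+1}²` of run A at `c` and of run B at `ι c` differ by at most
`Δ`.  Since every tested plaquette family is FINITE and NONEMPTY (dag-n21-d `plaqInside_cubeEnl_nonempty`), the sup is attained and the one inequality gives both dominations (§1 generic,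
§2 at def-R's local backgrounds).  The converse also holds (§1), so nothing is lost.

WHAT IS PROVED ([folklore] finite sups + [bookkeeping]).
* §1 `forall_exists_le_add_of_sup'_le` (finite nonempty `S, S′`: `sup′ f′ ≤ sup′ f + Δ` ⇒ `∀ q′ ∈ S′, ∃ q ∈ S, f′ q′ ≤ f q + Δ`) · `sup'_le_add_of_forall_exists` (converse) ·
  `dominations_of_abs_sup'_sub_le` (`|sup′ f − sup′ f′| ≤ Δ` ⇒ both directions).
* §2b `cubeStat_eq_sup'` · ★★ `bgDominations_of_cubeStat_close` — the same keyed to dag-n21-d's NAMED statistic `cubeStat` read at the χ_{k+1} cubes (`Kc := p.K`, level `k+1`):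
  `∀ c, |cubeStat^A_{k+1}(c)(V) − cubeStat^B_{k′+1}(ι c)(V′)| ≤ Δ` ⇒ `hAB ∧ hBA`.
* §3 ★ `fluctDominations_of_supStat_close` — the (3.3) twin: sup-closeness of the tested FLUCTUATION statistics (nonempty starred bond families displayed) ⇒ the
  bond-wise domination binders of file 7 `…GappedCollarDesignIJunctionPair` verbatim.
* §2 ★★ `bgDominations_of_supStat_close` — at the χ_{k+1}-cubes of two run data through `ι`: `∀ c, |stat^A(c)(V) − stat^B(ι c)(V′)| ≤ Δ` (inline `Finset.sup'` statistics in
  threshold units) ⇒ the pair `hAB ∧ hBA` of file 3 VERBATIM · ★★ `aWeightAt_sub_core_le_aWeightAt_sub_aGapAt_of_supStat_close` (file 3's ★★★ junction re-keyed to the sup-closeness).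

HONEST FRAMING.  The sup-closeness is a DISPLAYED hypothesis (N16's two-run closeness at the indicator's scale; NOT PRINTED), inhabited for no family here; nothing about the backgrounds
proved; nothing of Bałaban's asserted; NE7c NOT PRINTED ∕ NOT proved; **N21 NOT discharged**; K3⁷∕K3⁸ NOT claimed; counts UNMOVED (typed 28∕28 · discharged 5∕27); never a count claim.
One finite four-torus programme at fixed `ε` — NOT ℝ⁴, NOT OS, NOT a mass gap, NOT the Clay problem.  No decl below carries a cite tag.
-/

open Finset

namespace Summit.QuantumFields.YangMills.Theorems.N21TwoRunDominationOfSupCloseness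

open Literature.MathematicalPhysics.QuantumFieldTheory.Balaban1983to89
open Literature.MathematicalPhysics.QuantumFieldTheory.Balaban1983to89.T4Continuum
open Literature.MathematicalPhysics.QuantumFieldTheory.Balaban1983to89.Node00
open B14.Eq216Concrete (ukBox)
open GaugeField (plaqHol)
open GaugeGroup (dist1)
open Summit.QuantumFields.YangMills.Theorems.N21ShellSplitOfRecord13CoPH (aGapAt plaqInside_cubeEnl_nonempty)
open Summit.QuantumFields.YangMills.Theorems.N21TwoRunDevice (aWeightAt_sub_core_le_aWeightAt_sub_aGapAt_of_bgClose)

/-! ## §1 Finite sups: one inequality between the sups gives the ∀∃ domination, and conversely -/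

section Generic

variable {α β : Type*}

/-- `sup′ f′ ≤ sup′ f + Δ` over finite nonempty families ⇒ every `f′ q′` is dominated by SOME `f q` up to `Δ` (the sup of `f` is attained). [folklore] -/
theorem forall_exists_le_add_of_sup'_le {S : Finset α} {S' : Finset β} (hS : S.Nonempty) (hS' : S'.Nonempty) {f : α → ℝ} {f' : β → ℝ} {Δ : ℝ}
    (h : S'.sup' hS' f' ≤ S.sup' hS f + Δ) : ∀ q' ∈ S', ∃ q ∈ S, f' q' ≤ f q + Δ := by
  obtain ⟨q, hq, hmax⟩ := Finset.exists_mem_eq_sup' hS f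
  intro q' hq'
  refine ⟨q, hq, ?_⟩
  have h1 : f' q' ≤ S'.sup' hS' f' := Finset.le_sup' f' hq'
  rw [hmax] at h
  linarith

/-- Converse: the ∀∃ domination gives `sup′ f′ ≤ sup′ f + Δ`. [folklore] -/
theorem sup'_le_add_of_forall_exists {S : Finset α} {S' : Finset β} (hS : S.Nonempty) (hS' : S'.Nonempty) {f : α → ℝ} {f' : β → ℝ} {Δ : ℝ}
    (h : ∀ q' ∈ S', ∃ q ∈ S, f' q' ≤ f q + Δ) : S'.sup' hS' f' ≤ S.sup' hS f + Δ := by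
  refine Finset.sup'_le hS' f' fun q' hq' => ?_
  obtain ⟨q, hq, hle⟩ := h q' hq'
  exact hle.trans (by linarith [Finset.le_sup' f hq])

/-- `|sup′ f − sup′ f′| ≤ Δ` ⇒ both dominations. [folklore] -/
theorem dominations_of_abs_sup'_sub_le {S : Finset α} {S' : Finset β} (hS : S.Nonempty) (hS' : S'.Nonempty) {f : α → ℝ} {f' : β → ℝ} {Δ : ℝ}
    (h : |S.sup' hS f - S'.sup' hS' f'| ≤ Δ) :
    (∀ q' ∈ S', ∃ q ∈ S, f' q' ≤ f q + Δ) ∧ (∀ q ∈ S, ∃ q' ∈ S', f q ≤ f' q' + Δ) := by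
  have h' := abs_sub_le_iff.1 h
  exact ⟨forall_exists_le_add_of_sup'_le hS hS' (by linarith [h'.2]), forall_exists_le_add_of_sup'_le hS' hS (by linarith [h'.1])⟩

end Generic

/-! ## §2 At def-R's local backgrounds on the χ_{k+1}-cubes of two run data -/

section AtRecord

variable (F : T4Family) (N : ℕ) [NeZero N] (ν : Stage7Numerics)

/-- The tested plaquette family of a χ_{k+1}-cube, as a `Finset`, is nonempty (dag-n21-d `plaqInside_cubeEnl_nonempty` at the χ_{k+1} side). [bookkeeping] -/
theorem plaqFinset_nonempty {p : B12.RunParams} {g : ℕ → ℝ} {k : ℕ} (c : Iχ F ν p g k) :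
    (Set.toFinite (plaqInside (cubeEnl (F.P p.K) (sideχ F ν p g k) c 1))).toFinset.Nonempty := by
  rw [Set.Finite.toFinset_nonempty]
  exact plaqInside_cubeEnl_nonempty F ν g p.K (k + 1) c

/-- ★★ **SUP-CLOSENESS OF THE TESTED STATISTICS ⇒ BOTH DOMINATION BINDERS.**  Two run data `(p, g, k)`, `(p′, g′, k′)`, top fields `V, V′`, a site identification `ι`; if for EVERY cube
`c` the inline sup statistics `sup_{q ⊂ c^∼} |U^A_{k+1,c}(V)(∂q) − 1| ∕ η² ` and `sup_{q′ ⊂ (ιc)^∼} |U^B_{k′+1,ιc}(V′)(∂q′) − 1| ∕ η′²` differ by at most `Δ`, then the pair `hAB ∧ hBA` of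
file 3 (`…TwoRunDeviceOfBgCloseness`) holds verbatim. [bookkeeping] -/
theorem bgDominations_of_supStat_close {p p' : B12.RunParams} {g g' : ℕ → ℝ} {k k' : ℕ} (ι : Iχ F ν p g k → Iχ F ν p' g' k')
    (V : GaugeField (F.P p.K) (k + 1) (SU N)) (V' : GaugeField (F.P p'.K) (k' + 1) (SU N)) {Δ : ℝ}
    (h : ∀ c : Iχ F ν p g k,
      |(Set.toFinite (plaqInside (cubeEnl (F.P p.K) (sideχ F ν p g k) c 1))).toFinset.sup' (plaqFinset_nonempty F ν c)
          (fun q => dist1 (plaqHol (ukBox (bgOfRecord (avOfRecord F N p.K) {U | PlaqSmall (ν.εreg * (F.P p.K).eta (k + 1) ^ 2) U}) ν.M₁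
            (cubeEnl (F.P p.K) (sideχ F ν p g k) c 4) (k + 1) V) q) / (F.P p.K).eta (k + 1) ^ 2) -
        (Set.toFinite (plaqInside (cubeEnl (F.P p'.K) (sideχ F ν p' g' k') (ι c) 1))).toFinset.sup' (plaqFinset_nonempty F ν (ι c))
          (fun q' => dist1 (plaqHol (ukBox (bgOfRecord (avOfRecord F N p'.K) {U | PlaqSmall (ν.εreg * (F.P p'.K).eta (k' + 1) ^ 2) U}) ν.M₁
            (cubeEnl (F.P p'.K) (sideχ F ν p' g' k') (ι c) 4) (k' + 1) V') q') / (F.P p'.K).eta (k' + 1) ^ 2)| ≤ Δ) :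
    (∀ c : Iχ F ν p g k, ∀ q' ∈ plaqInside (cubeEnl (F.P p'.K) (sideχ F ν p' g' k') (ι c) 1), ∃ q ∈ plaqInside (cubeEnl (F.P p.K) (sideχ F ν p g k) c 1),
      dist1 (plaqHol (ukBox (bgOfRecord (avOfRecord F N p'.K) {U | PlaqSmall (ν.εreg * (F.P p'.K).eta (k' + 1) ^ 2) U}) ν.M₁
          (cubeEnl (F.P p'.K) (sideχ F ν p' g' k') (ι c) 4) (k' + 1) V') q') / (F.P p'.K).eta (k' + 1) ^ 2 ≤
        dist1 (plaqHol (ukBox (bgOfRecord (avOfRecord F N p.K) {U | PlaqSmall (ν.εreg * (F.P p.K).eta (k + 1) ^ 2) U}) ν.M₁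
          (cubeEnl (F.P p.K) (sideχ F ν p g k) c 4) (k + 1) V) q) / (F.P p.K).eta (k + 1) ^ 2 + Δ) ∧
    (∀ c : Iχ F ν p g k, ∀ q ∈ plaqInside (cubeEnl (F.P p.K) (sideχ F ν p g k) c 1), ∃ q' ∈ plaqInside (cubeEnl (F.P p'.K) (sideχ F ν p' g' k') (ι c) 1),
      dist1 (plaqHol (ukBox (bgOfRecord (avOfRecord F N p.K) {U | PlaqSmall (ν.εreg * (F.P p.K).eta (k + 1) ^ 2) U}) ν.M₁
          (cubeEnl (F.P p.K) (sideχ F ν p g k) c 4) (k + 1) V) q) / (F.P p.K).eta (k + 1) ^ 2 ≤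
        dist1 (plaqHol (ukBox (bgOfRecord (avOfRecord F N p'.K) {U | PlaqSmall (ν.εreg * (F.P p'.K).eta (k' + 1) ^ 2) U}) ν.M₁
          (cubeEnl (F.P p'.K) (sideχ F ν p' g' k') (ι c) 4) (k' + 1) V') q') / (F.P p'.K).eta (k' + 1) ^ 2 + Δ) := by
  constructor
  · intro c q' hq'
    obtain ⟨hAB, -⟩ := dominations_of_abs_sup'_sub_le (plaqFinset_nonempty F ν c) (plaqFinset_nonempty F ν (ι c)) (h c)
    obtain ⟨q, hq, hle⟩ := hAB q' (by simpa using hq')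
    exact ⟨q, by simpa using hq, hle⟩
  · intro c q hq
    obtain ⟨-, hBA⟩ := dominations_of_abs_sup'_sub_le (plaqFinset_nonempty F ν c) (plaqFinset_nonempty F ν (ι c)) (h c)
    obtain ⟨q', hq', hle⟩ := hBA q (by simpa using hq)
    exact ⟨q', by simpa using hq', hle⟩

/-- ★★ **FILE 3's JUNCTION RE-KEYED TO THE SUP-CLOSENESS**: with `0 ≤ Δ`, the per-cube sup-closeness through `ι`, and a collar `θlo + Δ ≤ θ ≤ θhi − Δ`: design (i)'s (3.2) deficit of
`a|_θ(P)(V)` against run B is at most dag-n21-d's gapped deficit `a|_θ(P)(V) − aGapAt θlo θhi s P V`. [bookkeeping] -/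
theorem aWeightAt_sub_core_le_aWeightAt_sub_aGapAt_of_supStat_close (M : ℕ) {p p' : B12.RunParams} {g g' : ℕ → ℝ} {k k' : ℕ} (ι : Iχ F ν p g k → Iχ F ν p' g' k')
    (V : GaugeField (F.P p.K) (k + 1) (SU N)) (V' : GaugeField (F.P p'.K) (k' + 1) (SU N)) {Δ : ℝ} (hΔ : 0 ≤ Δ)
    (h : ∀ c : Iχ F ν p g k,
      |(Set.toFinite (plaqInside (cubeEnl (F.P p.K) (sideχ F ν p g k) c 1))).toFinset.sup' (plaqFinset_nonempty F ν c)
          (fun q => dist1 (plaqHol (ukBox (bgOfRecord (avOfRecord F N p.K) {U | PlaqSmall (ν.εreg * (F.P p.K).eta (k + 1) ^ 2) U}) ν.M₁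
            (cubeEnl (F.P p.K) (sideχ F ν p g k) c 4) (k + 1) V) q) / (F.P p.K).eta (k + 1) ^ 2) -
        (Set.toFinite (plaqInside (cubeEnl (F.P p'.K) (sideχ F ν p' g' k') (ι c) 1))).toFinset.sup' (plaqFinset_nonempty F ν (ι c))
          (fun q' => dist1 (plaqHol (ukBox (bgOfRecord (avOfRecord F N p'.K) {U | PlaqSmall (ν.εreg * (F.P p'.K).eta (k' + 1) ^ 2) U}) ν.M₁
            (cubeEnl (F.P p'.K) (sideχ F ν p' g' k') (ι c) 4) (k' + 1) V') q') / (F.P p'.K).eta (k' + 1) ^ 2)| ≤ Δ)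
    {θlo θ θhi : ℝ} (hlo : θlo + Δ ≤ θ) (hhi : θ + Δ ≤ θhi) (s : SeqOfRecord F ν M g p.K k) {Pl : Finset (Iχ F ν p g k)} (hP : Pl ⊆ cubes32 F ν M p g k s) :
    aWeightAt F N ν M p g k θ s Pl V -
        (∏ c ∈ cubes32 F ν M p g k s \ Pl, (chiFactorAt F N ν p g k θ c V * chiFactorAt F N ν p' g' k' θ (ι c) V')) *
          ∏ c ∈ Pl, ((1 - chiFactorAt F N ν p g k θ c V) * (1 - chiFactorAt F N ν p' g' k' θ (ι c) V')) ≤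
      aWeightAt F N ν M p g k θ s Pl V - aGapAt F N ν M p g k θlo θhi s Pl V := by
  obtain ⟨hAB, hBA⟩ := bgDominations_of_supStat_close F N ν ι V V' h
  exact aWeightAt_sub_core_le_aWeightAt_sub_aGapAt_of_bgClose F N ν M ι V V' hΔ hAB hBA hlo hhi s hP

end AtRecord

/-! ## §2b The same keyed to dag-n21-d's NAMED statistic `cubeStat` (read at the χ_{k+1} cubes: `Kc := p.K`, level `k + 1`) -/

section CubeStat

open Summit.QuantumFields.YangMills.Theorems.N21ShellSplitOfRecord13CoPH (cubeStat eta_pos_record)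

variable (F : T4Family) (N : ℕ) [NeZero N] (ν : Stage7Numerics)

/-- `cubeStat` at a χ_{k+1}-cube IS the inline `sup′` statistic of §2 (the plaquette family is nonempty, so the `dif` takes its first branch; the division by `η² > 0` commutes with
`sup′`). [bookkeeping] -/
theorem cubeStat_eq_sup' {p : B12.RunParams} {g : ℕ → ℝ} {k : ℕ} (c : Iχ F ν p g k) (V : GaugeField (F.P p.K) (k + 1) (SU N)) :
    cubeStat F N ν g (Kc := p.K) (k := k + 1) c V =
      (Set.toFinite (plaqInside (cubeEnl (F.P p.K) (sideχ F ν p g k) c 1))).toFinset.sup' (plaqFinset_nonempty F ν c)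
        (fun q => dist1 (plaqHol (ukBox (bgOfRecord (avOfRecord F N p.K) {U | PlaqSmall (ν.εreg * (F.P p.K).eta (k + 1) ^ 2) U}) ν.M₁
          (cubeEnl (F.P p.K) (sideχ F ν p g k) c 4) (k + 1) V) q) / (F.P p.K).eta (k + 1) ^ 2) := by
  have hη : 0 < (F.P p.K).eta (k + 1) ^ 2 := pow_pos (eta_pos_record F p.K (k + 1)) 2
  have hne := plaqFinset_nonempty F ν c
  unfold cubeStat
  simp only
  split_ifs with h
  · rw [Finset.apply_sup'_eq_sup'_comp h (fun x : ℝ => x / (F.P p.K).eta (k + 1) ^ 2) (fun x y => (max_div_div_right hη.le x y).symm)]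
    rfl
  · exact absurd hne h

/-- ★★ **`cubeStat`-CLOSENESS ⇒ BOTH DOMINATION BINDERS**: `∀ c, |cubeStat^A_{k+1}(c)(V) − cubeStat^B_{k′+1}(ι c)(V′)| ≤ Δ` (dag-n21-d's named (2.17) statistic of record in threshold
units, read at the two runs' top levels) ⇒ the pair `hAB ∧ hBA` of file 3. [bookkeeping] -/
theorem bgDominations_of_cubeStat_close {p p' : B12.RunParams} {g g' : ℕ → ℝ} {k k' : ℕ} (ι : Iχ F ν p g k → Iχ F ν p' g' k')
    (V : GaugeField (F.P p.K) (k + 1) (SU N)) (V' : GaugeField (F.P p'.K) (k' + 1) (SU N)) {Δ : ℝ}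
    (h : ∀ c : Iχ F ν p g k, |cubeStat F N ν g (Kc := p.K) (k := k + 1) c V - cubeStat F N ν g' (Kc := p'.K) (k := k' + 1) (ι c) V'| ≤ Δ) :
    (∀ c : Iχ F ν p g k, ∀ q' ∈ plaqInside (cubeEnl (F.P p'.K) (sideχ F ν p' g' k') (ι c) 1), ∃ q ∈ plaqInside (cubeEnl (F.P p.K) (sideχ F ν p g k) c 1),
      dist1 (plaqHol (ukBox (bgOfRecord (avOfRecord F N p'.K) {U | PlaqSmall (ν.εreg * (F.P p'.K).eta (k' + 1) ^ 2) U}) ν.M₁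
          (cubeEnl (F.P p'.K) (sideχ F ν p' g' k') (ι c) 4) (k' + 1) V') q') / (F.P p'.K).eta (k' + 1) ^ 2 ≤
        dist1 (plaqHol (ukBox (bgOfRecord (avOfRecord F N p.K) {U | PlaqSmall (ν.εreg * (F.P p.K).eta (k + 1) ^ 2) U}) ν.M₁
          (cubeEnl (F.P p.K) (sideχ F ν p g k) c 4) (k + 1) V) q) / (F.P p.K).eta (k + 1) ^ 2 + Δ) ∧
    (∀ c : Iχ F ν p g k, ∀ q ∈ plaqInside (cubeEnl (F.P p.K) (sideχ F ν p g k) c 1), ∃ q' ∈ plaqInside (cubeEnl (F.P p'.K) (sideχ F ν p' g' k') (ι c) 1),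
      dist1 (plaqHol (ukBox (bgOfRecord (avOfRecord F N p.K) {U | PlaqSmall (ν.εreg * (F.P p.K).eta (k + 1) ^ 2) U}) ν.M₁
          (cubeEnl (F.P p.K) (sideχ F ν p g k) c 4) (k + 1) V) q) / (F.P p.K).eta (k + 1) ^ 2 ≤
        dist1 (plaqHol (ukBox (bgOfRecord (avOfRecord F N p'.K) {U | PlaqSmall (ν.εreg * (F.P p'.K).eta (k' + 1) ^ 2) U}) ν.M₁
          (cubeEnl (F.P p'.K) (sideχ F ν p' g' k') (ι c) 4) (k' + 1) V') q') / (F.P p'.K).eta (k' + 1) ^ 2 + Δ) := by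
  refine bgDominations_of_supStat_close F N ν ι V V' fun c => ?_
  rw [← cubeStat_eq_sup' F N ν c V, ← cubeStat_eq_sup' F N ν (ι c) V']
  exact h c

end CubeStat


/-! ## §3 The (3.3) twin: sup-closeness of the tested FLUCTUATION statistics ⇒ the bond-wise domination binders of file 7 -/

section Fluct

open B14.Sect3Decomp (Vbox)

variable (F : T4Family) (N : ℕ) [NeZero N] (ν : Stage7Numerics) (M : ℕ)

/-- ★ **(3.3) SUP-CLOSENESS ⇒ BOTH BOND-WISE DOMINATIONS** (the binders `hAB ∕ hBA` of file 7 `…GappedCollarDesignIJunctionPair`, verbatim): two run data with old histories `s, s′`,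
field pairs `(U, V)`, `(U′, V′)`, a site identification `ι`, NONEMPTY starred bond families on both sides (displayed), and ONE inequality per cube between the inline `Finset.sup'`
statistics `sup_{b} |U(b)(V-box_c(b))⁻¹ − 1|` of run A at `c` and of run B at `ι c`. [bookkeeping] -/
theorem fluctDominations_of_supStat_close {p p' : B12.RunParams} {g g' : ℕ → ℝ} {k k' : ℕ} (ι : Iχ F ν p g k → Iχ F ν p' g' k')
    (s : SeqOfRecord F ν M g p.K k) (s' : SeqOfRecord F ν M g' p'.K k') (U : GaugeField (F.P p.K) k (SU N)) (V : GaugeField (F.P p.K) (k + 1) (SU N))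
    (U' : GaugeField (F.P p'.K) k' (SU N)) (V' : GaugeField (F.P p'.K) (k' + 1) (SU N)) {Δ : ℝ}
    (hneA : ∀ c : Iχ F ν p g k, ((sect3DataOfRecord F N ν M p g k s).bondsStar c).Nonempty)
    (hneB : ∀ c : Iχ F ν p g k, ((sect3DataOfRecord F N ν M p' g' k' s').bondsStar (ι c)).Nonempty)
    (h : ∀ c : Iχ F ν p g k,
      |((sect3DataOfRecord F N ν M p g k s).bondsStar c).sup' (hneA c)
          (fun b => dist1 (U b * (Vbox (sect3DataOfRecord F N ν M p g k s) (avOfRecord F N p.K) c V b)⁻¹)) -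
        ((sect3DataOfRecord F N ν M p' g' k' s').bondsStar (ι c)).sup' (hneB c)
          (fun b' => dist1 (U' b' * (Vbox (sect3DataOfRecord F N ν M p' g' k' s') (avOfRecord F N p'.K) (ι c) V' b')⁻¹))| ≤ Δ) :
    (∀ c : Iχ F ν p g k, ∀ b' ∈ (sect3DataOfRecord F N ν M p' g' k' s').bondsStar (ι c), ∃ b ∈ (sect3DataOfRecord F N ν M p g k s).bondsStar c,
      dist1 (U' b' * (Vbox (sect3DataOfRecord F N ν M p' g' k' s') (avOfRecord F N p'.K) (ι c) V' b')⁻¹) ≤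
        dist1 (U b * (Vbox (sect3DataOfRecord F N ν M p g k s) (avOfRecord F N p.K) c V b)⁻¹) + Δ) ∧
    (∀ c : Iχ F ν p g k, ∀ b ∈ (sect3DataOfRecord F N ν M p g k s).bondsStar c, ∃ b' ∈ (sect3DataOfRecord F N ν M p' g' k' s').bondsStar (ι c),
      dist1 (U b * (Vbox (sect3DataOfRecord F N ν M p g k s) (avOfRecord F N p.K) c V b)⁻¹) ≤
        dist1 (U' b' * (Vbox (sect3DataOfRecord F N ν M p' g' k' s') (avOfRecord F N p'.K) (ι c) V' b')⁻¹) + Δ) :=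
  ⟨fun c => (dominations_of_abs_sup'_sub_le (hneA c) (hneB c) (h c)).1, fun c => (dominations_of_abs_sup'_sub_le (hneA c) (hneB c) (h c)).2⟩

end Fluct

end Summit.QuantumFields.YangMills.Theorems.N21TwoRunDominationOfSupCloseness
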